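import Summits.ResolutionOfSingularities.KangarooAtlas.MizutaniHSchemeExponent
import HarnessLib

/-!
# Mizutani 1973, THEOREM 1.3 as printed (Oda 1973 [O1] Thm. 2.5): the graded `k[F]`-modules `U(𝔭) ∩ L` of the H-schemes

Cell `pub-rosobs`, Mizutani enclosure (seat mizutani-encloser-1, gen 9).  AI-written; *AI review is weaker than
expert review*; NOT a resolution-of-singularities theorem (summit relevance C).

«THEOREM 1.3 (Oda [3], Th. 2.5). Let `N` be a graded left `k[F]`-submodule of `L`.  Then `Spec(S/N·S)` is an H-scheme of
exponent `e` if and only if `e(N) = e`, `N_e ⊊ L_e`, `𝒥_e𝒟_e(N_e) = N_e` and `N = rad_L(k[F]N_e)`, where `rad_L(Q) = {f ∈ L | F^j f ∈ Q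
for some j}`.  Moreover `γ(𝒟_e(N_e)·S)` is the most generic point associated with `Spec(S/N·S)` and `dim Spec(S/N·S) = dim_k(L_e/N_e)`.»

In the tree a graded family of additive forms is `N : ℕ → Submodule k (Fin (n+1) → k)` (`N j` = the coefficient vectors of the forms of
degree `p^j`), `U(𝔭) ∩ L = hirForms k p 𝔭`, `U_+(𝔭)S = bIdeal k 𝔭`, `N·S = famIdeal k p N`, and «`Spec(S/N·S)` is the H-scheme of exponent
`e` of the point `𝔭`» is read as «`N = U(𝔭) ∩ L` levelwise and `exponent B(𝔭) = e`» (then `N·S = U_+(𝔭)S`, `bIdeal_eq_famIdeal_hirForms_holds`).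
The four conditions, levelwise: `e(N) = e` ⟺ `N_j = k·F^{j−e}N_e` for `j ≥ e` and (for `e ≥ 1`) `N_e ≠ k·F N_{e−1}`; with
`N = rad_L(k[F]N_e)` ⟺ `N_j = F^{−(e−j)}(N_e)` for `j ≤ e`, the second clause reads `N_e ≠ span_k(N_e ∩ F(k^{n+1}))` (Mizutani's (iii)).

* **`mizutani1973_theorem13`** — the IFF, assembled from `jCore_dSpan_invForms` / `exists_isPoint_invForms_eq_iff` (𝒥𝒟-closure,
  `MizutaniOdaOperators`, `MizutaniHSchemeCriterion`), `mem_invForms_iff_frobVec_mem` (`rad_L`, `MizutaniLevelRadical`), `ExponentLE` /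
  `exponentLE_iff_eq_span_inter_range` (`e(N) = e`, `MizutaniHSchemeExponent`), `invForms_ne_top`, `hirForms_eq_invForms` (Oda's equality);
* **`mizutani1973_theorem13_moreover`** — under the four conditions, `𝔤 = rad(𝒟_e(N_e)·S)` is a point with `U(𝔤) ∩ L = N`, exponent `e`,
  `U_+(𝔤)S = N·S` (`Spec(S/N·S) = B_{P,𝔤}`), `𝔤 ⊆` every point `𝔶` with `U_+(𝔶)S = N·S`, and `dim S/N·S = n + 1 − dim_k N_e`.

References: H. Mizutani, Nagoya Math. J. 52 (1973), Thm. 1.3, §1 (c), (d) [Mizutani1973HironakaGroupSchemes]; T. Oda, Publ. RIMS 19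
(1983), §2 p. 1168, Lemma 2.1, Cor. 2.3 [Oda1983HironakaGroupSchemeII].
-/

noncomputable section

open MvPolynomial Literature.AlgebraicGeometry.Resolution Literature.AlgebraicGeometry.Resolution.HironakaScheme
  Literature.RingTheory.MvPolynomial Literature.RingTheory.HilbertSamuel

namespace Summit.ResolutionOfSingularities.KangarooAtlas.Mizutani

universe u

section Theorem13

variable (k : Type u) [Field k] (p : ℕ) [hp : Fact p.Prime] [CharP k p] {n : ℕ}

/-- For a point: `exponent B(𝔭) = e` iff `ExponentLE e` and, when `e ≥ 1`, `(L_B)_e` is not spanned by its vectors with coordinates in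
`k^p` (Mizutani's «`N_e ≠ k·F N_{e−1}`»). [cite: Mizutani1973HironakaGroupSchemes, §1 (c) (the exponent e(Q))] -/
theorem exponent_eq_iff_span_inter (𝔭 : Ideal (MvPolynomial (Fin (n + 1)) k)) [𝔭.IsPrime] (hP : IsPoint k 𝔭) (e : ℕ) :
    exponent k p 𝔭 = e ↔ ExponentLE k p 𝔭 e ∧
      (0 < e → invForms k p 𝔭 e ≠
        Submodule.span k ((invForms k p 𝔭 e : Set (Fin (n + 1) → k)) ∩ Set.range (frobVec k p 1))) := by
  constructor
  · rintro rfl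
    refine ⟨exponentLE_exponent k p 𝔭, fun hpos h => ?_⟩
    obtain ⟨e', he'⟩ := Nat.exists_eq_succ_of_ne_zero hpos.ne'
    have hE : ExponentLE k p 𝔭 (e' + 1) := (exponent_le_iff k p 𝔭).mp he'.le
    rw [he'] at h
    have hle : exponent k p 𝔭 ≤ e' :=
      (exponent_le_iff k p 𝔭).mpr ((exponentLE_iff_eq_span_inter_range k p 𝔭 e' hP hE).mpr h)
    omega
  · rintro ⟨hE, hex⟩
    refine le_antisymm ((exponent_le_iff k p 𝔭).mpr hE) ?_
    by_contra hlt
    push Not at hlt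
    obtain ⟨e', rfl⟩ := Nat.exists_eq_succ_of_ne_zero (by omega : e ≠ 0)
    have hle : ExponentLE k p 𝔭 e' := (exponent_le_iff k p 𝔭).mp (by omega)
    exact hex (Nat.succ_pos e') ((exponentLE_iff_eq_span_inter_range k p 𝔭 e' hP hE).mp hle)

/-- **MIZUTANI 1973, THEOREM 1.3 (= Oda 1973 Thm. 2.5), AS PRINTED.**  For a graded family `N = (N_j)_j` of additive forms
(`N_j ⊆ k^{n+1} = L_j` the coefficient vectors in degree `p^j`): `N = U(𝔭) ∩ L` for a point `𝔭` of `ℙ^n_k` whose H-scheme `B_{P,𝔭}` has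
exponent `e` **iff** (1) `N_j = k·F^{j−e} N_e` for `j ≥ e`, (2) `N_j = {a : F^{e−j} a ∈ N_e}` for `j ≤ e` (`N = rad_L(k[F]N_e)`), (3) for `e ≥ 1`,
`N_e ≠ span_k(N_e ∩ F(k^{n+1}))` (with (1): `e(N) = e`), (4) `N_e ⊊ L_e`, (5) `𝒥_e𝒟_e(N_e) = N_e`.  AI-written; *AI review is weaker than expert
review*; not a resolution theorem. [cite: Mizutani1973HironakaGroupSchemes, Thm. 1.3] -/
theorem mizutani1973_theorem13 (N : ℕ → Submodule k (Fin (n + 1) → k)) (e : ℕ) :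
    (∃ (𝔭 : Ideal (MvPolynomial (Fin (n + 1)) k)) (_ : 𝔭.IsPrime),
        IsPoint k 𝔭 ∧ exponent k p 𝔭 = e ∧ ∀ j, hirForms k p 𝔭 j = N j) ↔
      ((∀ j, e ≤ j → N j = Submodule.span k (frobVec k p (j - e) '' (N e : Set (Fin (n + 1) → k)))) ∧
        (∀ j, j ≤ e → ∀ a, a ∈ N j ↔ frobVec k p (e - j) a ∈ N e) ∧
        (0 < e → N e ≠ Submodule.span k ((N e : Set (Fin (n + 1) → k)) ∩ Set.range (frobVec k p 1))) ∧
        N e ≠ ⊤ ∧ jCore k p e (dSpan k p e (N e)) = N e) := by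
  constructor
  · rintro ⟨𝔭, _, hP, hexp, hN⟩
    have hN' : ∀ j, invForms k p 𝔭 j = N j := fun j => (hirForms_eq_invForms 𝔭 j).symm.trans (hN j)
    obtain ⟨hE, hex⟩ := (exponent_eq_iff_span_inter k p 𝔭 hP e).mp hexp
    refine ⟨fun j hj => ?_, fun j hj a => ?_, fun hpos => ?_, ?_, ?_⟩
    · rw [← hN' j, ← hN' e]; exact hE j hj
    · obtain ⟨m, rfl⟩ := Nat.exists_eq_add_of_le hj
      rw [← hN' j, ← hN' (j + m), Nat.add_sub_cancel_left]
      exact mem_invForms_iff_frobVec_mem k p 𝔭 hP j m a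
    · rw [← hN' e]; exact hex hpos
    · rw [← hN' e]; exact invForms_ne_top k p e 𝔭 hP
    · rw [← hN' e]; exact jCore_dSpan_invForms k p 𝔭 e
  · rintro ⟨hgen, hrad, hex, hne, hcl⟩
    set 𝔤 := qLinPoint k p e (dSpan k p e (N e)) with h𝔤
    haveI := isPrime_qLinPoint k p e (dSpan k p e (N e))
    obtain ⟨hG, hEG, hinv, -⟩ := qLinPoint_dSpan_realises k p e hne hcl
    have hall : ∀ j, invForms k p 𝔤 j = N j := by
      intro j
      rcases le_or_gt j e with hj | hj
      · obtain ⟨m, rfl⟩ := Nat.exists_eq_add_of_le hj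
        ext a
        rw [mem_invForms_iff_frobVec_mem k p 𝔤 hG j m a, hinv, hrad j hj a, Nat.add_sub_cancel_left]
      · rw [hEG j hj.le, hinv, hgen j hj.le]
    refine ⟨𝔤, inferInstance, hG, ?_, fun j => (hirForms_eq_invForms 𝔤 j).trans (hall j)⟩
    refine (exponent_eq_iff_span_inter k p 𝔤 hG e).mpr ⟨hEG, fun hpos => ?_⟩
    rw [hinv]; exact hex hpos

/-- **THEOREM 1.3, «MOREOVER» CLAUSES, AS PRINTED**: under the conditions of `mizutani1973_theorem13`, the ideal `𝔤 := rad(𝒟_e(N_e)·S)`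
(the radical of the ideal generated by the `p^e`-th power forms with coefficient vectors in `𝒟_e(N_e)`) is a point of `ℙ^n_k` with
`U(𝔤) ∩ L = N`, `exponent B(𝔤) = e`, `U_+(𝔤)S = N·S` — so `Spec(S/N·S) = B_{P,𝔤}` IS an H-scheme —, it is the MOST GENERIC point with this scheme
(contained in every point `𝔶` with `U_+(𝔶)S = N·S`), and `dim Spec(S/N·S) = n + 1 − dim_k N_e = dim_k(L_e/N_e)`.  AI-written; *AI review is
weaker than expert review*. [cite: Mizutani1973HironakaGroupSchemes, Thm. 1.3 ("Moreover …") and §1 (d)] -/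
theorem mizutani1973_theorem13_moreover (N : ℕ → Submodule k (Fin (n + 1) → k)) (e : ℕ)
    (hgen : ∀ j, e ≤ j → N j = Submodule.span k (frobVec k p (j - e) '' (N e : Set (Fin (n + 1) → k))))
    (hrad : ∀ j, j ≤ e → ∀ a, a ∈ N j ↔ frobVec k p (e - j) a ∈ N e)
    (hex : 0 < e → N e ≠ Submodule.span k ((N e : Set (Fin (n + 1) → k)) ∩ Set.range (frobVec k p 1)))
    (hne : N e ≠ ⊤) (hcl : jCore k p e (dSpan k p e (N e)) = N e) :
    let 𝔤 := (Ideal.span (addForm k p e '' (dSpan k p e (N e) : Set (Fin (n + 1) → k)))).radical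
    ∃ _ : 𝔤.IsPrime, IsPoint k 𝔤 ∧ (∀ j, hirForms k p 𝔤 j = N j) ∧ exponent k p 𝔤 = e ∧
      bIdeal k 𝔤 = famIdeal k p N ∧
      (∀ (𝔶 : Ideal (MvPolynomial (Fin (n + 1)) k)) [𝔶.IsPrime], IsPoint k 𝔶 → bIdeal k 𝔶 = famIdeal k p N → 𝔤 ≤ 𝔶) ∧
      ringKrullDim (MvPolynomial (Fin (n + 1)) k ⧸ famIdeal k p N) = ((n + 1 - Module.finrank k (N e) : ℕ) : WithBot ℕ∞) := by
  intro 𝔤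
  have h𝔤 : 𝔤 = qLinPoint k p e (dSpan k p e (N e)) := radical_span_addForm k p e _
  haveI hprime : 𝔤.IsPrime := h𝔤 ▸ isPrime_qLinPoint k p e (dSpan k p e (N e))
  -- the point realising `N` (as in the theorem)
  haveI := isPrime_qLinPoint k p e (dSpan k p e (N e))
  obtain ⟨hG, hEG, hinv, -⟩ := qLinPoint_dSpan_realises k p e hne hcl
  have hall : ∀ j, invForms k p (qLinPoint k p e (dSpan k p e (N e))) j = N j := by
    intro j
    rcases le_or_gt j e with hj | hj
    · obtain ⟨m, rfl⟩ := Nat.exists_eq_add_of_le hj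
      ext a
      rw [mem_invForms_iff_frobVec_mem k p _ hG j m a, hinv, hrad j hj a, Nat.add_sub_cancel_left]
    · rw [hEG j hj.le, hinv, hgen j hj.le]
  clear_value 𝔤
  subst h𝔤
  have hhir : ∀ j, hirForms k p (qLinPoint k p e (dSpan k p e (N e))) j = N j :=
    fun j => (hirForms_eq_invForms _ j).trans (hall j)
  have hexp : exponent k p (qLinPoint k p e (dSpan k p e (N e))) = e :=
    (exponent_eq_iff_span_inter k p _ hG e).mpr ⟨hEG, fun hpos => by rw [hinv]; exact hex hpos⟩
  have hfam : bIdeal k (qLinPoint k p e (dSpan k p e (N e))) = famIdeal k p N := by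
    rw [bIdeal_eq_famIdeal_hirForms_holds k p _ hG, show hirForms k p (qLinPoint k p e (dSpan k p e (N e))) = N from funext hhir]
  refine ⟨hprime, hG, hhir, hexp, hfam, fun 𝔶 _ hY hb => ?_, ?_⟩
  · -- most generic: `𝔶` carries the same invariant forms, in particular `N_e ⊆ (L_B)_e(𝔶)`
    refine qLinPoint_dSpan_le k p e fun a ha => ?_
    rw [← hirForms_eq_invForms 𝔶 e, ← addForm_mem_bIdeal_iff k p 𝔶 hY, hb, ← hfam,
      addForm_mem_bIdeal_iff k p _ hG, hhir e]
    exact ha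
  · rw [← hfam, ringKrullDim_quotient_bIdeal_holds k p _ hG (e₀ := e) fun j hj => by
      rw [hhir j, hhir e]; exact (hgen j hj).le, hhir e]

end Theorem13

/-! ## Level `0`: `𝒟_0 = 𝒥_0 = id` — every proper subspace of linear forms is `(U ∩ L)_0` of a vector group -/

section LevelZero

variable (k : Type u) [Field k] (p : ℕ) [hp : Fact p.Prime] [CharP k p] {n : ℕ}

/-- An operator of level `0` (order `≤ p^0 − 1 = 0`) is a multiplication: `D v = D(1) • v`. [cite: EGAIV4, Prop. 16.8.8 (order ≤ 0)] -/
theorem apply_eq_smul_of_level_zero {D : k →ₗ[frobPow k p 0] k} (hD : IsDiffOpLE (frobPow k p 0) (p ^ 0 - 1) D)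
    (v : Fin (n + 1) → k) : (fun i => D (v i)) = D 1 • v := by
  rw [pow_zero, Nat.sub_self, isDiffOpLE_zero_iff_eq_mulLeft] at hD
  funext i
  rw [Pi.smul_apply, smul_eq_mul]
  conv_lhs => rw [hD, LinearMap.mulLeft_apply]

/-- **`𝒟_0(V) = V`** (the operators of order `0` are the multiplications by scalars). [cite: Mizutani1973HironakaGroupSchemes, §1 (b) (𝒟_0 = Diff_0(k)·V = k·V)] -/
theorem dSpan_zero_eq (V : Submodule k (Fin (n + 1) → k)) : dSpan k p 0 V = V := by
  refine le_antisymm ?_ (le_dSpan k p 0 V)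
  unfold dSpan
  rw [Submodule.span_le]
  rintro _ ⟨v, hv, D, hD, rfl⟩
  rw [SetLike.mem_coe, apply_eq_smul_of_level_zero k p hD]
  exact V.smul_mem _ hv

/-- **`𝒥_0(U) = U`.** [cite: Mizutani1973HironakaGroupSchemes, §1 (b)] -/
theorem jCore_zero_eq (U : Submodule k (Fin (n + 1) → k)) : jCore k p 0 U = U := by
  refine le_antisymm (jCore_le k p 0 U) fun a ha D hD => ?_
  rw [apply_eq_smul_of_level_zero k p hD]
  exact U.smul_mem _ ha

/-- At level `0` every subspace is `𝒥_0𝒟_0`-closed, so **every proper subspace `V ⊊ k^{n+1}` is the space `(U(𝔭) ∩ L)_0` of linear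
forms of a point of exponent `0`** (a vector group: the linear point of `V`) — Thm. 1.3 / (*) at `e = 0`.
[cite: Mizutani1973HironakaGroupSchemes, Thm. 1.3 and Remark 1.2] -/
theorem exists_isPoint_invForms_zero_eq (V : Submodule k (Fin (n + 1) → k)) (hV : V ≠ ⊤) :
    ∃ 𝔭 : Ideal (MvPolynomial (Fin (n + 1)) k), IsPoint k 𝔭 ∧ ExponentLE k p 𝔭 0 ∧ invForms k p 𝔭 0 = V :=
  (exists_isPoint_invForms_eq_iff k p 0 V).mpr ⟨hV, by rw [dSpan_zero_eq, jCore_zero_eq]⟩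

end LevelZero

end Summit.ResolutionOfSingularities.KangarooAtlas.Mizutani

end
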